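import Literature.IUT.HodgeArakelov.PlusMinusTowerCyclicToy
import HarnessLib

/-!
# [IUTchII] Cor. 2.4 (i): the named fact `Cor24_i W C H I` is a SCHEMA — universal-closure certificate at a finite tower
# with `Π̂^±_v ⊋ Π^±_v` (proof-only)

S. Mochizuki, *Inter-universal Teichmüller theory II*, kurims manuscript (Dec. 2020), §2, Corollary 2.4 (i) pp. 69–71
[claim: Mochizuki2012, status: disputed] (IUTchII §2 Cor 2.4 (i), kurims pp.69-71).  abc-iut cell, D-0079 L-K «cone below S,
unconditional», K-L6 slice (abc-iut-w4-d007 gen 10, row «KL6-CLOSURE-CERTS»).  PROOF-ONLY companion of abc-iut-L6-t1's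
`LabelClassesOfCusps.lean` over abc-iut-w5-d243's cyclic toy setting (`PlusMinusTowerCyclicToy.lean`); no `def`, no `instance`.

The frozen FACT-LIST row **F-1949** `Cor24_i` occurs in HYPOTHESIS position inside the typed statement of the L6 cone row
IUTchII:Cor2.4(ii) (abc-iut-w5-d012 `L6-SLICE-INPUT-CENSUS-v2`, ca24e4516e42b12c; label `conditional`).  The tree held an
instance-form theorem (`cor24_i'_ofPiCHat_ofSpecialFibre`, abc-iut L6, at the genuine tower from the [EtTh] model and a special
fibre) and a CONDITIONAL refuter (abc-iut-w4-d012's `not_cor24_i_of_pmBox_le_piV`, seven hypotheses on the tower), but no decision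
of the universal closure.  `Cor24_i W C H I` is a predicate on an ARBITRARY tower `W : PlusMinusTower T` (interface record:
`Π_v ⊆ Π^±_v ⊆ Π̂^±_v ⊆ Π̂^cor_v ↠ G_v` with the printed indices `l`, `2l`), an ARBITRARY cuspidal-inertia predicate
`C : CuspidalInertiaData W` (interface: any predicate `IsCuspidalInertia Q I` with `I ≤ Q`), any `Π_{v□} = H` and any `I`.
Two degenerations falsify it (`not_cor24_i_bot_of_not_mem_piPM`): (1) a predicate `C` for which the TRIVIAL subgroup counts as a
cuspidal inertia group of `Π_v` — then conditions (b)/(c) of Cor. 2.4 (i) hold for every `γ'`, so (a) would force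
`Δ̂^±_v ⊆ Δ^±_{v□} ⊆ Π^±_v`; (2) a tower with `Δ̂^±_v ⊄ Π^±_v` — automatic in print (`Π^±_v` tempered, `Π̂^±_v` its profinite
completion) but NOT in abc-iut-w5-d243's cyclic toy, where all groups are finite and `Π̂^±_v = Π^±_v`.  This file supplies such a
tower over the SAME toy setting (`cyclicBadPlaceSetting 3 5`, `cyclicCoverings 3 5`: `Π_v = 1`, `Π^tp_{X_v} = ℤ/3`, `G_v = 1`):
`Π̂^cor_v := ℤ/2 × ℤ/3 × ℤ/3 × ℤ/3`, `Π̂^±_v := 0 × 0 × ℤ/3 × ℤ/3` (index `2l = 6`), `Π̂_v := 0 × 0 × 0 × ℤ/3` (index `l = 3` in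
`Π̂^±_v`), `Π^±_v ↪ Π̂^±_v` the third coordinate — every axiom of `PlusMinusTower` PROVED, and `γ' := (0,0,0,1) ∈ Δ̂^±_v ∖ Π^±_v`.
Hence `exists_plusMinusTower_not_cor24_i` and the CLOSED certificate `not_forall_cor24_i`: the universal closure of F-1949 is
FALSE; the row is consumable only in instance form at the genuine data (`cor24_i'_ofPiCHat_ofSpecialFibre`,
`cor24_i_of_inputs_mem`, `cor24_i'_of_agreements` BY NAME) — FACT-LIST class «universal-closure REFUTED / schema; instance forms …».

HONEST FRAMING: a refuted universal closure is a statement about OUR typing (the interface records admit degenerate inhabitants: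
finite groups, a vacuous inertia predicate), not about the printed corollary (genuine cuspidal inertia groups are infinite
procyclic, [IUTchI] Cor. 2.5 applies); nothing here bears on [IUTchIII] Cor. 3.12 or takes a side; typed ≠ proved; nothing
asserts abc proved or refuted.
-/

noncomputable section

namespace Literature.IUT.HodgeArakelov

open Multiplicative

universe u

/-! ## Which degeneration kills the corollary -/

section General

variable {S : BadPlaceSetting.{u}} {P : TopGroup.{u}} {T : TemperedCoverings S P}

/-- **IUTchII:Cor2.4(i)** (kurims pp.69-70) fails for `I := 1` whenever the inertia predicate accepts the trivial subgroup as a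
cuspidal inertia group of `Π_v` and some `γ' ∈ Δ̂^±_v` lies outside `Π^±_v`: conditions (b), (c) are then vacuous, while (a)
`γ' ∈ Δ^±_{v□} ⊆ N_{Π^±_v}(Π_{v□}) ⊆ Π^±_v` is not. [claim: Mochizuki2012, status: disputed] (IUTchII §2 Cor 2.4 (i), kurims pp.69-70) -/
theorem not_cor24_i_bot_of_not_mem_piPM (W : PlusMinusTower T) (C : CuspidalInertiaData W)
    (hC : C.IsCuspidalInertia W.piV ⊥) (H : Subgroup P) {γ' : W.Corhat} (hγ' : γ' ∈ W.pmHat ⊓ W.aug.ker)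
    (hγ'pm : γ' ∉ W.piPM) : ¬ Cor24_i W C H ⊥ := by
  intro h
  have h1 : (1 : W.Corhat) ∈ W.pmHat ⊓ W.aug.ker := Subgroup.one_mem _
  have key := (h hC bot_le 1 γ' h1 hγ').1
  have hle : (⊥ : Subgroup W.Corhat).map (MulAut.conj (1 * γ')).toMonoidHom ≤
      (W.box H).map (MulAut.conj 1).toMonoidHom := by
    rw [Subgroup.map_bot]
    exact bot_le
  have hmem : γ' ∈ W.deltaPmBox H := key.mpr hle
  have hpm : W.deltaPmBox H ≤ W.piPM := fun x hx => (Subgroup.map_subtype_le _) (Subgroup.mem_inf.mp hx).1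
  exact hγ'pm (hpm hmem)

end General

/-! ## A tower over the cyclic toy setting with `Π̂^±_v ⊋ Π^±_v`, and the closed certificate -/

/-- **IUTchII:Def2.3(i)** / **Cor2.4(i)** (kurims pp.67-70) Over abc-iut-w5-d243's toy setting (`l = 3`, `p = 5`, `Π_v = 1`,
`Π^tp_{X_v} = ℤ/3`, `G_v = 1`) there is a tower `Π_v ⊆ Π^±_v ⊆ Π̂^±_v ⊆ Π̂^cor_v` satisfying every `PlusMinusTower` axiom
(indices `[Δ̂^±_v : Δ̂_v] = 3`, `[Δ̂^cor_v : Δ̂^±_v] = 6`) with `Π̂^±_v = (ℤ/3)² ⊋ Π^±_v = ℤ/3`, together with a cuspidal-inertia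
predicate accepting the trivial group, at which `Cor24_i W C Π_v 1` FAILS.
[claim: Mochizuki2012, status: disputed] (IUTchII §2 Cor 2.4 (i), kurims pp.69-70) -/
theorem exists_plusMinusTower_not_cor24_i :
    ∃ (W : PlusMinusTower (CyclicToy.cyclicCoverings 3 5 Nat.prime_three (by decide) Nat.prime_five (by decide)
        (by decide))) (C : CuspidalInertiaData W), C.IsCuspidalInertia W.piV ⊥ ∧ ¬ Cor24_i W C ⊤ ⊥ := by
  haveI : Fact (1 < 3) := ⟨by decide⟩
  -- the ambient `Π̂^cor_v := ℤ/2 × ℤ/3 × ℤ/3 × ℤ/3` and the three structural homomorphisms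
  let ι34 : Multiplicative (ZMod 3 × ZMod 3) →* Multiplicative (ZMod 2 × (ZMod 3 × (ZMod 3 × ZMod 3))) :=
    AddMonoidHom.toMultiplicative
      ((AddMonoidHom.inr (ZMod 2) (ZMod 3 × (ZMod 3 × ZMod 3))).comp (AddMonoidHom.inr (ZMod 3) (ZMod 3 × ZMod 3)))
  let ι4 : Multiplicative (ZMod 3) →* Multiplicative (ZMod 2 × (ZMod 3 × (ZMod 3 × ZMod 3))) :=
    ι34.comp (AddMonoidHom.toMultiplicative (AddMonoidHom.inr (ZMod 3) (ZMod 3)))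
  let g : CyclicToy.Amb 3 →* Multiplicative (ZMod 2 × (ZMod 3 × (ZMod 3 × ZMod 3))) :=
    AddMonoidHom.toMultiplicative
      (AddMonoidHom.prodMap (AddMonoidHom.id (ZMod 2))
        (AddMonoidHom.prodMap (AddMonoidHom.id (ZMod 3)) (AddMonoidHom.inl (ZMod 3) (ZMod 3))))
  -- explicit formulas
  have hι34 : ∀ c d : ZMod 3, ι34 (ofAdd (c, d)) = ofAdd (0, (0, (c, d))) := fun _ _ => rfl
  have hg : ∀ (a : ZMod 2) (b c : ZMod 3), g (ofAdd (a, (b, c))) = ofAdd (a, (b, (c, 0))) := fun _ _ _ => rfl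
  have hgι : ∀ c : Multiplicative (ZMod 3), g (CyclicToy.ιpm 3 c) = ι34 (ofAdd (toAdd c, 0)) := fun _ => rfl
  -- injectivity
  have hι34_inj : Function.Injective ι34 := by
    intro x y hxy
    have := congrArg (fun z => (toAdd z).2.2) hxy
    exact toAdd.injective this
  have hι4_inj : Function.Injective ι4 := by
    intro x y hxy
    have := congrArg (fun z => (toAdd z).2.2.2) hxy
    exact toAdd.injective this
  have hg_inj : Function.Injective g := by
    intro x y hxy
    obtain ⟨⟨a, b, c⟩, rfl⟩ := ofAdd.surjective x
    obtain ⟨⟨a', b', c'⟩, rfl⟩ := ofAdd.surjective y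
    rw [hg, hg] at hxy
    have h' := congrArg toAdd hxy
    simp only [toAdd_ofAdd, Prod.mk.injEq] at h'
    obtain ⟨rfl, rfl, rfl, -⟩ := h'
    rfl
  -- cardinalities and indices
  have hcardA : Nat.card (Multiplicative (ZMod 2 × (ZMod 3 × (ZMod 3 × ZMod 3)))) = 54 := by
    rw [Nat.card_congr (toAdd : Multiplicative (ZMod 2 × (ZMod 3 × (ZMod 3 × ZMod 3))) ≃ _), Nat.card_prod,
      Nat.card_prod, Nat.card_prod, Nat.card_zmod, Nat.card_zmod]
  have hcard34 : Nat.card ι34.range = 9 := by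
    rw [← Nat.card_congr (MonoidHom.ofInjective hι34_inj).toEquiv,
      Nat.card_congr (toAdd : Multiplicative (ZMod 3 × ZMod 3) ≃ _), Nat.card_prod, Nat.card_zmod]
  have hcard4 : Nat.card ι4.range = 3 := by
    rw [← Nat.card_congr (MonoidHom.ofInjective hι4_inj).toEquiv,
      Nat.card_congr (toAdd : Multiplicative (ZMod 3) ≃ _), Nat.card_zmod]
  have hidx34 : ι34.range.index = 2 * 3 := by
    have h := ι34.range.index_mul_card
    rw [hcard34, hcardA] at h
    omega
  have hidx4 : ι4.range.index = 18 := by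
    have h := ι4.range.index_mul_card
    rw [hcard4, hcardA] at h
    omega
  have hle : ι4.range ≤ ι34.range := by
    rintro _ ⟨d, rfl⟩
    exact ⟨_, rfl⟩
  have hrel : (ι4.range.subgroupOf ι34.range).index = 3 := by
    have h := Subgroup.relIndex_mul_index hle
    rw [hidx34, hidx4] at h
    change ι4.range.relIndex ι34.range = 3
    omega
  -- the tower
  let W : PlusMinusTower (CyclicToy.cyclicCoverings 3 5 Nat.prime_three (by decide) Nat.prime_five (by decide)
      (by decide)) :=
    { Corhat := TopGroup.of (Multiplicative (ZMod 2 × (ZMod 3 × (ZMod 3 × ZMod 3))))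
      cor := ⊤
      pmHat := ι34.range
      hat := ι4.range
      emb := g.comp (CyclicToy.Hpm 3).subtype
      emb_injective := hg_inj.comp Subtype.val_injective
      aug := 1
      aug_surjective := fun _ => ⟨1, Subsingleton.elim _ _⟩
      hat_le_pmHat := hle
      emb_le_pmHat := by
        rintro _ ⟨x, rfl⟩
        obtain ⟨c, hc⟩ := x.2
        show g (x : CyclicToy.Amb 3) ∈ ι34.range
        rw [← hc, hgι]
        exact ⟨_, rfl⟩
      embP_le_hat := by
        rintro _ ⟨x, rfl⟩
        have hx : ((x : ↥(⊥ : Subgroup (CyclicToy.Amb 3))) : CyclicToy.Amb 3) = 1 := x.2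
        show g ((Subgroup.inclusion bot_le x : ↥(CyclicToy.Hpm 3)) : CyclicToy.Amb 3) ∈ ι4.range
        rw [Subgroup.coe_inclusion, hx, map_one]
        exact Subgroup.one_mem _
      embP_le_cor := le_top
      pmHat_normal := inferInstance
      deltaHat_normal := inferInstance
      deltaHat_index := by
        show ((ι4.range ⊓ (1 : Multiplicative (ZMod 2 × (ZMod 3 × (ZMod 3 × ZMod 3))) →*
            Multiplicative (ZMod 1)).ker).subgroupOf (ι34.range ⊓ (1 : Multiplicative (ZMod 2 × (ZMod 3 ×
              (ZMod 3 × ZMod 3))) →* Multiplicative (ZMod 1)).ker)).index = 3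
        rw [MonoidHom.ker_one, inf_top_eq, inf_top_eq]
        exact hrel
      deltaPmHat_normal := inferInstance
      deltaPmHat_index := by
        show ((ι34.range ⊓ (1 : Multiplicative (ZMod 2 × (ZMod 3 × (ZMod 3 × ZMod 3))) →*
            Multiplicative (ZMod 1)).ker).subgroupOf (1 : Multiplicative (ZMod 2 × (ZMod 3 × (ZMod 3 × ZMod 3))) →*
              Multiplicative (ZMod 1)).ker).index = 2 * 3
        rw [MonoidHom.ker_one, inf_top_eq]
        change ι34.range.relIndex ⊤ = 2 * 3
        rw [Subgroup.relIndex_top_right, hidx34]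
      aug_compat := ⟨ContinuousMulEquiv.refl _, fun _ => Subsingleton.elim _ _⟩ }
  -- the vacuous cuspidal-inertia predicate: exactly the trivial subgroup
  let C : CuspidalInertiaData W :=
    { IsCuspidalInertia := fun _ I => I = ⊥
      le_of_isCuspidalInertia := by
        intro Q I h
        rw [h]
        exact bot_le }
  refine ⟨W, C, rfl, ?_⟩
  -- `γ' := (0,0,0,1) ∈ Δ̂^±_v ∖ Π^±_v`
  have hγ' : ι4 (ofAdd 1) ∈ W.pmHat ⊓ W.aug.ker :=
    ⟨hle ⟨ofAdd 1, rfl⟩, MonoidHom.mem_ker.mpr (Subsingleton.elim _ _)⟩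
  have hγ'pm : ι4 (ofAdd 1) ∉ W.piPM := by
    rintro ⟨x, hx⟩
    obtain ⟨c, hc⟩ := x.2
    have hx' : g (CyclicToy.ιpm 3 c) = ι4 (ofAdd 1) := by
      rw [hc]
      exact hx
    have key : (toAdd (g (CyclicToy.ιpm 3 c))).2.2.2 = (toAdd (ι4 (ofAdd 1))).2.2.2 := by rw [hx']
    have h0 : (toAdd (g (CyclicToy.ιpm 3 c))).2.2.2 = (0 : ZMod 3) := rfl
    have h1 : (toAdd (ι4 (ofAdd (1 : ZMod 3)))).2.2.2 = (1 : ZMod 3) := rfl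
    rw [h0, h1] at key
    exact absurd key (by decide)
  exact not_cor24_i_bot_of_not_mem_piPM W C rfl ⊤ hγ' hγ'pm

/-- **F-1949 is a schema**: the universal closure of `Cor24_i` (over all bad-place settings, tempered coverings, towers,
cuspidal-inertia predicates, `Π_{v□}` and `I`) is FALSE; the instance forms the cone uses are `cor24_i'_ofPiCHat_ofSpecialFibre` /
`cor24_i_of_inputs_mem` / `cor24_i'_of_agreements` (genuine tower, genuine cuspidal inertia groups, [IUTchI] Cor 2.3/2.5 inputs BY
NAME). [claim: Mochizuki2012, status: disputed] (IUTchII §2 Cor 2.4 (i), kurims pp.69-71) -/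
theorem not_forall_cor24_i :
    ¬ ∀ (S : BadPlaceSetting.{0}) (P : TopGroup.{0}) (T : TemperedCoverings S P) (W : PlusMinusTower T)
        (C : CuspidalInertiaData W) (H : Subgroup P) (I : Subgroup W.Corhat), Cor24_i W C H I := by
  intro h
  obtain ⟨W, C, -, hW⟩ := exists_plusMinusTower_not_cor24_i
  exact hW (h _ _ _ W C ⊤ ⊥)

end Literature.IUT.HodgeArakelov

end
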